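import Mathlib
import Summits.Ventures.PercRepro2.HalfLTwoMarkPoly

/-!
# The twelve Bernstein certificates of `HalfLTwoMark.lhs` (blind cell PercRepro2, night-1 g37)

`C_{k₁k₂}` below is `9 ·` the `(k₁, k₂)` coefficient of the `(3,3)`-Bernstein expansion of `lhs` in `(r₁, r₂)`,
written as the explicit nonnegative integer combination of `cell × block` and cubic cell monomials found by the
exact simplex (`mining/night-1/g37/deg2stage2.py`, `deg2stage2_results.json`); **`lhs_bern`** is the identity
`9 · lhs = Σ C(3,k₁) C(3,k₂) r₁^{k₁} (1−r₁)^{3−k₁} r₂^{k₂} (1−r₂)^{3−k₂} · C_{k₁k₂}` (pure `ring`).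
-/

namespace Summit.Ventures.PercRepro2

namespace HalfLTwoMark

section Certs

variable {R : Type*} [CommRing R]

/-- `9 · c_{00}`: the certificate of the Bernstein coefficient `(0, 0)` (9 terms). -/
def C00 (c : Cells R) : R :=
  (9 : R) * (c.LL * blkHHN c) + (9 : R) * (c.LH * blkHHN c) + (9 : R) * (c.LN * blkHHN c) +
    (9 : R) * (c.HL * blkHHN c) + (9 : R) * (c.HH * blkHHN c) + (9 : R) * (c.HN * blkHHN c) +
    (9 : R) * (c.NL * blkHHN c) + (9 : R) * (c.NH * blkHHN c) + (9 : R) * (c.NN * blkHHN c)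

/-- `9 · c_{01}`: the certificate of the Bernstein coefficient `(0, 1)` (21 terms). -/
def C01 (c : Cells R) : R :=
  (3 : R) * (c.LL * blkLLN c) + (3 : R) * (c.HL * blkLLN c) + (3 : R) * (c.NL * blkLLN c) +
    (3 : R) * (c.LL * blkHHN c) + (6 : R) * (c.LH * blkHHN c) + (6 : R) * (c.LN * blkHHN c) +
    (3 : R) * (c.HL * blkHHN c) + (6 : R) * (c.HH * blkHHN c) + (6 : R) * (c.HN * blkHHN c) +
    (3 : R) * (c.NL * blkHHN c) + (6 : R) * (c.NH * blkHHN c) + (6 : R) * (c.NN * blkHHN c) +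
    (3 : R) * (c.LL * blkM2 c) + (3 : R) * (c.LH * blkM2 c) + (3 : R) * (c.LN * blkM2 c) +
    (3 : R) * (c.HL * blkM2 c) + (3 : R) * (c.HH * blkM2 c) + (3 : R) * (c.HN * blkM2 c) +
    (3 : R) * (c.NL * blkM2 c) + (3 : R) * (c.NH * blkM2 c) + (3 : R) * (c.NN * blkM2 c)

/-- `9 · c_{02}`: the certificate of the Bernstein coefficient `(0, 2)` (21 terms). -/
def C02 (c : Cells R) : R :=
  (3 : R) * (c.LL * blkLLN c) + (3 : R) * (c.HL * blkLLN c) + (3 : R) * (c.NL * blkLLN c) +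
    (3 : R) * (c.LH * blkHHN c) + (3 : R) * (c.LN * blkHHN c) + (3 : R) * (c.HH * blkHHN c) +
    (3 : R) * (c.HN * blkHHN c) + (3 : R) * (c.NH * blkHHN c) + (3 : R) * (c.NN * blkHHN c) +
    (3 : R) * (c.LL * blkM2 c) + (6 : R) * (c.LH * blkM2 c) + (6 : R) * (c.LN * blkM2 c) +
    (3 : R) * (c.HL * blkM2 c) + (6 : R) * (c.HH * blkM2 c) + (6 : R) * (c.HN * blkM2 c) +
    (3 : R) * (c.NL * blkM2 c) + (6 : R) * (c.NH * blkM2 c) + (6 : R) * (c.NN * blkM2 c) +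
    (3 : R) * (c.LL * blkM1 c) + (3 : R) * (c.HL * blkM1 c) + (3 : R) * (c.NL * blkM1 c)

/-- `9 · c_{03}`: the certificate of the Bernstein coefficient `(0, 3)` (9 terms). -/
def C03 (c : Cells R) : R :=
  (9 : R) * (c.LH * blkM2 c) + (9 : R) * (c.LN * blkM2 c) + (9 : R) * (c.HH * blkM2 c) +
    (9 : R) * (c.HN * blkM2 c) + (9 : R) * (c.NH * blkM2 c) + (9 : R) * (c.NN * blkM2 c) +
    (9 : R) * (c.LL * blkM1 c) + (9 : R) * (c.HL * blkM1 c) + (9 : R) * (c.NL * blkM1 c)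

/-- `9 · c_{10}`: the certificate of the Bernstein coefficient `(1, 0)` (9 terms). -/
def C10 (c : Cells R) : R :=
  (6 : R) * (c.LL * blkHHN c) + (6 : R) * (c.LH * blkHHN c) + (6 : R) * (c.LN * blkHHN c) +
    (6 : R) * (c.HL * blkHHN c) + (6 : R) * (c.HH * blkHHN c) + (6 : R) * (c.HN * blkHHN c) +
    (6 : R) * (c.NL * blkHHN c) + (6 : R) * (c.NH * blkHHN c) + (6 : R) * (c.NN * blkHHN c)

/-- `9 · c_{20}`: the certificate of the Bernstein coefficient `(2, 0)` (9 terms). -/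
def C20 (c : Cells R) : R :=
  (3 : R) * (c.LL * blkHHN c) + (3 : R) * (c.LH * blkHHN c) + (3 : R) * (c.LN * blkHHN c) +
    (3 : R) * (c.HL * blkHHN c) + (3 : R) * (c.HH * blkHHN c) + (3 : R) * (c.HN * blkHHN c) +
    (3 : R) * (c.NL * blkHHN c) + (3 : R) * (c.NH * blkHHN c) + (3 : R) * (c.NN * blkHHN c)

/-- `9 · c_{11}`: the certificate of the Bernstein coefficient `(1, 1)` (58 terms). -/
def C11 (c : Cells R) : R :=
  (2 : R) * (c.LL * blkLLN c) + (2 : R) * (c.HL * blkLLN c) + (c.HH * blkLLN c) +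
    (c.HN * blkLLN c) + (c.LN * blkHH c) + (c.NL * blkHH c) + (2 : R) * (c.LL * blkHHN c) +
    (2 : R) * (c.LH * blkHHN c) + (2 : R) * (c.LN * blkHHN c) + (c.HH * blkHHN c) +
    (c.HN * blkHHN c) + (c.NH * blkHHN c) + (c.LH * blkM2 c) + (2 : R) * (c.LN * blkM2 c) +
    (2 : R) * (c.HL * blkM2 c) + (2 : R) * (c.HH * blkM2 c) + (2 : R) * (c.HN * blkM2 c) +
    (3 : R) * (c.NL * blkM2 c) + (3 : R) * (c.NH * blkM2 c) + (3 : R) * (c.NN * blkM2 c) +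
    (c.HN * blkM1 c) + (2 : R) * (c.HL * blkM2o c) + (2 : R) * (c.NL * blkM2o c) +
    (3 : R) * (c.LL * blkM1o c) + (3 : R) * (c.LH * blkM1o c) + (3 : R) * (c.LN * blkM1o c) +
    (c.HL * blkM1o c) + (3 : R) * (c.HH * blkM1o c) + (3 : R) * (c.HN * blkM1o c) +
    (c.NL * blkM1o c) + (3 : R) * (c.NH * blkM1o c) + (3 : R) * (c.NN * blkM1o c) +
    (2 : R) * (c.LL * c.LL * c.HN) + (2 : R) * (c.LL * c.LH * c.HL) +
    (2 : R) * (c.LL * c.LH * c.HH) + (3 : R) * (c.LL * c.LH * c.HN) +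
    (2 : R) * (c.LL * c.LN * c.HH) + (3 : R) * (c.LL * c.LN * c.HN) +
    (2 : R) * (c.LL * c.HL * c.HH) + (2 : R) * (c.LL * c.HL * c.HN) +
    (2 : R) * (c.LL * c.HL * c.NH) + (2 : R) * (c.LL * c.HL * c.NN) +
    (2 : R) * (c.LL * c.HH * c.HH) + (5 : R) * (c.LL * c.HH * c.HN) +
    (2 : R) * (c.LL * c.HH * c.NH) + (4 : R) * (c.LL * c.HH * c.NN) +
    (3 : R) * (c.LL * c.HN * c.HN) + (c.LL * c.HN * c.NH) + (3 : R) * (c.LL * c.HN * c.NN) +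
    (c.LH * c.LN * c.HH) + (2 : R) * (c.LH * c.LN * c.HN) + (c.LH * c.HH * c.HN) +
    (c.LH * c.HH * c.NN) + (2 : R) * (c.LH * c.HN * c.HN) + (2 : R) * (c.LH * c.HN * c.NN) +
    (c.LN * c.LN * c.HN) + (c.LN * c.HN * c.HN) + (c.LN * c.HN * c.NN)

/-- `9 · c_{12}`: the certificate of the Bernstein coefficient `(1, 2)` (57 terms). -/
def C12 (c : Cells R) : R :=
  (2 : R) * (c.HH * blkLL c) + (c.LN * blkLLN c) + (2 : R) * (c.HN * blkLLN c) +
    (c.LN * blkHH c) + (2 : R) * (c.LL * blkHHN c) + (2 : R) * (c.LH * blkM2 c) +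
    (2 : R) * (c.LN * blkM2 c) + (c.HL * blkM2 c) + (4 : R) * (c.HH * blkM2 c) +
    (4 : R) * (c.HN * blkM2 c) + (2 : R) * (c.NL * blkM2 c) + (4 : R) * (c.NH * blkM2 c) +
    (4 : R) * (c.NN * blkM2 c) + (2 : R) * (c.LL * blkM1 c) + (7 : R) * (c.HL * blkM1 c) +
    (c.HH * blkM1 c) + (c.HN * blkM1 c) + (2 : R) * (c.NL * blkM1 c) +
    (2 : R) * (c.LL * blkM2o c) + (2 : R) * (c.HL * blkM2o c) + (2 : R) * (c.NL * blkM2o c) +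
    (4 : R) * (c.LH * blkM1o c) + (5 : R) * (c.LN * blkM1o c) + (2 : R) * (c.HH * blkM1o c) +
    (2 : R) * (c.HN * blkM1o c) + (2 : R) * (c.NH * blkM1o c) + (2 : R) * (c.NN * blkM1o c) +
    (2 : R) * (c.LL * c.LH * c.HL) + (2 : R) * (c.LL * c.LH * c.HH) +
    (2 : R) * (c.LL * c.LH * c.HN) + (2 : R) * (c.LL * c.LN * c.HL) +
    (3 : R) * (c.LL * c.LN * c.HH) + (5 : R) * (c.LL * c.LN * c.HN) +
    (2 : R) * (c.LL * c.HL * c.HH) + (c.LL * c.HL * c.HN) + (2 : R) * (c.LL * c.HL * c.NH) +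
    (c.LL * c.HL * c.NN) + (2 : R) * (c.LL * c.HN * c.HN) + (2 : R) * (c.LL * c.HN * c.NN) +
    (2 : R) * (c.LH * c.LN * c.HL) + (c.LH * c.LN * c.HH) + (3 : R) * (c.LH * c.LN * c.HN) +
    (2 : R) * (c.LH * c.HL * c.HH) + (7 : R) * (c.LH * c.HL * c.HN) +
    (2 : R) * (c.LH * c.HL * c.NH) + (7 : R) * (c.LH * c.HL * c.NN) + (c.LH * c.HH * c.HN) +
    (c.LH * c.HH * c.NN) + (3 : R) * (c.LH * c.HN * c.HN) + (3 : R) * (c.LH * c.HN * c.NN) +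
    (2 : R) * (c.LN * c.LN * c.HN) + (c.LN * c.HL * c.HL) + (3 : R) * (c.LN * c.HL * c.HN) +
    (c.LN * c.HL * c.NL) + (3 : R) * (c.LN * c.HL * c.NN) + (2 : R) * (c.LN * c.HN * c.HN) +
    (2 : R) * (c.LN * c.HN * c.NN)

/-- `9 · c_{13}`: the certificate of the Bernstein coefficient `(1, 3)` (23 terms). -/
def C13 (c : Cells R) : R :=
  (6 : R) * (c.LH * blkM2 c) + (6 : R) * (c.LN * blkM2 c) + (6 : R) * (c.HH * blkM2 c) +
    (6 : R) * (c.HN * blkM2 c) + (6 : R) * (c.NH * blkM2 c) + (6 : R) * (c.NN * blkM2 c) +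
    (6 : R) * (c.LL * blkM1 c) + (3 : R) * (c.LN * blkM1 c) + (6 : R) * (c.HL * blkM1 c) +
    (3 : R) * (c.HN * blkM1 c) + (6 : R) * (c.NL * blkM1 c) + (6 : R) * (c.LH * c.LN * c.HL) +
    (3 : R) * (c.LH * c.LN * c.HN) + (6 : R) * (c.LH * c.HL * c.HN) +
    (6 : R) * (c.LH * c.HL * c.NN) + (3 : R) * (c.LH * c.HN * c.HN) +
    (3 : R) * (c.LH * c.HN * c.NN) + (6 : R) * (c.LN * c.LN * c.HL) +
    (3 : R) * (c.LN * c.LN * c.HN) + (6 : R) * (c.LN * c.HL * c.HN) +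
    (6 : R) * (c.LN * c.HL * c.NN) + (3 : R) * (c.LN * c.HN * c.HN) +
    (3 : R) * (c.LN * c.HN * c.NN)

/-- `9 · c_{21}`: the certificate of the Bernstein coefficient `(2, 1)` (61 terms). -/
def C21 (c : Cells R) : R :=
  (c.HH * blkLL c) + (c.LL * blkLLN c) + (c.HL * blkLLN c) + (2 : R) * (c.HN * blkLLN c) +
    (c.NL * blkLLN c) + (c.LH * blkHH c) + (c.LN * blkHH c) + (c.LL * blkHHN c) +
    (c.LL * blkM2 c) + (3 : R) * (c.LH * blkM2 c) + (c.LN * blkM2 c) + (c.HL * blkM2 c) +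
    (c.HH * blkM2 c) + (c.HN * blkM2 c) + (c.NL * blkM2 c) + (c.NH * blkM2 c) + (c.NN * blkM2 c) +
    (2 : R) * (c.HL * blkM1 c) + (c.HH * blkM1 c) + (c.LL * blkM1o c) +
    (2 : R) * (c.LH * blkM1o c) + (3 : R) * (c.LN * blkM1o c) + (2 : R) * (c.HH * blkM1o c) +
    (2 : R) * (c.HN * blkM1o c) + (c.NL * blkM1o c) + (2 : R) * (c.NH * blkM1o c) +
    (2 : R) * (c.NN * blkM1o c) + (2 : R) * (c.LL * c.LH * c.HL) + (c.LL * c.LH * c.HH) +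
    (2 : R) * (c.LL * c.LN * c.HL) + (2 : R) * (c.LL * c.LN * c.HH) +
    (3 : R) * (c.LL * c.LN * c.HN) + (c.LL * c.HL * c.HH) + (c.LL * c.HL * c.HN) +
    (2 : R) * (c.LL * c.HL * c.NH) + (2 : R) * (c.LL * c.HL * c.NN) + (c.LL * c.HH * c.HH) +
    (c.LL * c.HH * c.HN) + (c.LL * c.HH * c.NH) + (c.LL * c.HH * c.NN) +
    (2 : R) * (c.LL * c.HN * c.HN) + (2 : R) * (c.LL * c.HN * c.NN) + (c.LH * c.LH * c.HL) +
    (c.LH * c.LH * c.HN) + (3 : R) * (c.LH * c.LN * c.HL) + (2 : R) * (c.LH * c.LN * c.HN) +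
    (c.LH * c.HL * c.HL) + (c.LH * c.HL * c.HH) + (4 : R) * (c.LH * c.HL * c.HN) +
    (c.LH * c.HL * c.NH) + (4 : R) * (c.LH * c.HL * c.NN) + (c.LH * c.HH * c.HN) +
    (2 : R) * (c.LH * c.HN * c.HN) + (c.LH * c.HN * c.NH) + (2 : R) * (c.LH * c.HN * c.NN) +
    (c.LN * c.LN * c.HN) + (c.LN * c.HL * c.HL) + (c.LN * c.HL * c.HN) + (c.LN * c.HL * c.NN) +
    (c.LN * c.HN * c.HN) + (c.LN * c.HN * c.NN)

/-- `9 · c_{22}`: the certificate of the Bernstein coefficient `(2, 2)` (55 terms). -/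
def C22 (c : Cells R) : R :=
  (c.HH * blkLL c) + (c.LL * blkLLN c) + (c.LN * blkLLN c) + (c.HN * blkLLN c) +
    (c.NL * blkLLN c) + (c.LN * blkHH c) + (c.LL * blkM2 c) + (2 : R) * (c.LH * blkM2 c) +
    (3 : R) * (c.LN * blkM2 c) + (2 : R) * (c.HH * blkM2 c) + (2 : R) * (c.HN * blkM2 c) +
    (c.NL * blkM2 c) + (2 : R) * (c.NH * blkM2 c) + (2 : R) * (c.NN * blkM2 c) +
    (c.LL * blkM1 c) + (4 : R) * (c.HL * blkM1 c) + (c.HH * blkM1 c) +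
    (2 : R) * (c.HN * blkM1 c) + (c.NL * blkM1 c) + (c.HL * blkM2o c) +
    (2 : R) * (c.LH * blkM1o c) + (c.LN * blkM1o c) + (c.HH * blkM1o c) + (c.HN * blkM1o c) +
    (c.NH * blkM1o c) + (c.NN * blkM1o c) + (c.LL * c.LH * c.HL) + (c.LL * c.LH * c.HH) +
    (c.LL * c.LH * c.HN) + (c.LL * c.LN * c.HL) + (c.LL * c.LN * c.HN) + (c.LL * c.HL * c.HH) +
    (c.LL * c.HL * c.HN) + (c.LL * c.HL * c.NN) + (c.LL * c.HN * c.HN) + (c.LL * c.HN * c.NN) +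
    (4 : R) * (c.LH * c.LN * c.HL) + (c.LH * c.LN * c.HH) + (3 : R) * (c.LH * c.LN * c.HN) +
    (c.LH * c.HL * c.HH) + (5 : R) * (c.LH * c.HL * c.HN) + (2 : R) * (c.LH * c.HL * c.NL) +
    (2 : R) * (c.LH * c.HL * c.NH) + (7 : R) * (c.LH * c.HL * c.NN) + (c.LH * c.HH * c.HN) +
    (c.LH * c.HH * c.NN) + (3 : R) * (c.LH * c.HN * c.HN) + (3 : R) * (c.LH * c.HN * c.NN) +
    (3 : R) * (c.LN * c.LN * c.HL) + (2 : R) * (c.LN * c.LN * c.HN) +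
    (3 : R) * (c.LN * c.HL * c.HN) + (c.LN * c.HL * c.NL) + (4 : R) * (c.LN * c.HL * c.NN) +
    (2 : R) * (c.LN * c.HN * c.HN) + (2 : R) * (c.LN * c.HN * c.NN)

/-- `9 · c_{23}`: the certificate of the Bernstein coefficient `(2, 3)` (23 terms). -/
def C23 (c : Cells R) : R :=
  (3 : R) * (c.LH * blkM2 c) + (3 : R) * (c.LN * blkM2 c) + (3 : R) * (c.HH * blkM2 c) +
    (3 : R) * (c.HN * blkM2 c) + (3 : R) * (c.NH * blkM2 c) + (3 : R) * (c.NN * blkM2 c) +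
    (3 : R) * (c.LL * blkM1 c) + (3 : R) * (c.LN * blkM1 c) + (3 : R) * (c.HL * blkM1 c) +
    (3 : R) * (c.HN * blkM1 c) + (3 : R) * (c.NL * blkM1 c) + (3 : R) * (c.LH * c.LN * c.HL) +
    (3 : R) * (c.LH * c.LN * c.HN) + (3 : R) * (c.LH * c.HL * c.HN) +
    (6 : R) * (c.LH * c.HL * c.NN) + (3 : R) * (c.LH * c.HN * c.HN) +
    (3 : R) * (c.LH * c.HN * c.NN) + (3 : R) * (c.LN * c.LN * c.HL) +
    (3 : R) * (c.LN * c.LN * c.HN) + (3 : R) * (c.LN * c.HL * c.HN) +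
    (6 : R) * (c.LN * c.HL * c.NN) + (3 : R) * (c.LN * c.HN * c.HN) +
    (3 : R) * (c.LN * c.HN * c.NN)

/-- **The certified Bernstein form**: `9 · lhs` as the `(3,3)`-Bernstein sum of the twelve certificates. -/
theorem lhs_bern (r₁ r₂ : R) (c : Cells R) :
    9 * lhs r₁ r₂ c =
      (1 - r₁) ^ 3 * (1 - r₂) ^ 3 * C00 c +
      (3 : R) * (1 - r₁) ^ 3 * r₂ * (1 - r₂) ^ 2 * C01 c +
      (3 : R) * (1 - r₁) ^ 3 * r₂ ^ 2 * (1 - r₂) * C02 c +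
      (1 - r₁) ^ 3 * r₂ ^ 3 * C03 c +
      (3 : R) * r₁ * (1 - r₁) ^ 2 * (1 - r₂) ^ 3 * C10 c +
      (3 : R) * r₁ ^ 2 * (1 - r₁) * (1 - r₂) ^ 3 * C20 c +
      (9 : R) * r₁ * (1 - r₁) ^ 2 * r₂ * (1 - r₂) ^ 2 * C11 c +
      (9 : R) * r₁ * (1 - r₁) ^ 2 * r₂ ^ 2 * (1 - r₂) * C12 c +
      (3 : R) * r₁ * (1 - r₁) ^ 2 * r₂ ^ 3 * C13 c +
      (9 : R) * r₁ ^ 2 * (1 - r₁) * r₂ * (1 - r₂) ^ 2 * C21 c +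
      (9 : R) * r₁ ^ 2 * (1 - r₁) * r₂ ^ 2 * (1 - r₂) * C22 c +
      (3 : R) * r₁ ^ 2 * (1 - r₁) * r₂ ^ 3 * C23 c := by
  unfold lhs mQ mbL mT mTbL mTbLoU moH mbLoH mToU mPD mPDoU C00 C01 C02 C03 C10 C20 C11 C12 C13 C21 C22 C23
    blkLL blkHH blkLLN blkHHN blkM1 blkM2 blkM1o blkM2o
  ring

end Certs


end HalfLTwoMark

end Summit.Ventures.PercRepro2
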